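import Literature.Computability.AlgebraicComplexity.JelisiejewLandsbergPal2023MinimalBorderRank
import Mathlib.LinearAlgebra.Eigenspace.Pi
import Mathlib.LinearAlgebra.Eigenspace.Triangularizable
import HarnessLib

/-!
# The 111-algebra of a concise tensor: products, powers, commutativity, and nilpotents

Solo programme `solo-MatrixMultiplication-informed` (gen 18), door D10 (catalysts for `cw₂`).
For `T ∈ K^Z ⊗ K^X ⊗ K^Y`, `𝔞(T) = ker (lin111 T)` is the space of triples `(P,Q,R)` with
`P ·₁ T = Q ·₂ T = R ·₃ T`.  For concise `T`: `IsTriple.mul` (`(PP', Q'Q, R'R) ∈ 𝔞(T)`, no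
commutativity needed), `IsTriple.pow`, injectivity of the three projections, `IsTriple.comm₁`
(JLP Thm. 1.10); **E3** `exists_ne_zero_isNilpotent_of_finrank_lt`: over an algebraically closed
field a space of pairwise commuting endomorphisms of `V` of dimension `> dim V` contains a non-zero
nilpotent (simultaneous generalised eigenspaces); hence
`exists_sqZero_triple_of_card_lt_finrank_ker_lin111`: a concise, 111-abundant, non-111-sharp tensor
carries a non-zero triple `(P,Q,R) ∈ 𝔞(T)` with `P² = Q² = R² = 0` — the algebraic input of the
gen-18 closure of the catalyst door (such a triple makes `T` unstable under `SL³`).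
References: [cite: JelisiejewLandsbergPal2023, Thm. 1.10, Def. 1.9, §1.4.1];
[cite: BuczynskaBuczynski2021, Thm. 1.2].
-/

open scoped BigOperators Matrix
open Matrix

namespace Summit.MatrixMultiplication.MatrixMultiplication.Theorems

open Literature.Computability.AlgebraicComplexity

namespace OneOneOneAlgebra

/-! ## E3: commuting spaces of endomorphisms of dimension `> dim V` contain nilpotents -/

section E3

open Module Module.End Set

variable {K : Type*} [Field K] {V : Type*} [AddCommGroup V] [Module K V] [FiniteDimensional K V]

/-- On the maximal generalised `μ`-eigenspace, `(f - μ)^{dim V}` vanishes pointwise. [folklore] -/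
theorem pow_finrank_apply_of_mem_maxGenEigenspace (f : End K V) (μ : K) {v : V}
    (hv : v ∈ f.maxGenEigenspace μ) : ((f - μ • (1 : End K V)) ^ finrank K V) v = 0 := by
  rw [maxGenEigenspace_eq_genEigenspace_finrank, mem_genEigenspace_nat, LinearMap.mem_ker] at hv
  exact hv

omit [FiniteDimensional K V] in
/-- Two commuting endomorphisms that are pointwise nilpotent at `v` have a pointwise nilpotent sum
at `v`. [folklore] -/
theorem add_pow_apply_eq_zero {g₁ g₂ : End K V} (hc : Commute g₁ g₂) {k₁ k₂ : ℕ} {v : V}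
    (h₁ : (g₁ ^ k₁) v = 0) (h₂ : (g₂ ^ k₂) v = 0) : ((g₁ + g₂) ^ (k₁ + k₂)) v = 0 := by
  have h₁' (j) : (g₁ ^ (k₁ + j)) v = 0 := by rw [add_comm, pow_add, Module.End.mul_apply, h₁, map_zero]
  have h₂' (j) : (g₂ ^ (j + k₂)) v = 0 := by rw [pow_add, Module.End.mul_apply, h₂, map_zero]
  have key : ∀ m, (g₁ ^ m * g₂ ^ (k₁ + k₂ - m)) v = 0 := by
    intro m
    rcases Nat.lt_or_ge m k₁ with hm | hm
    · rw [Module.End.mul_apply, show k₁ + k₂ - m = (k₁ - m) + k₂ from by omega, h₂', map_zero]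
    · obtain ⟨j, rfl⟩ := Nat.exists_eq_add_of_le hm
      rw [(hc.pow_pow _ _).eq, Module.End.mul_apply, h₁', map_zero]
  rw [hc.add_pow, LinearMap.sum_apply]
  refine Finset.sum_eq_zero fun m _ => ?_
  rw [← Nat.cast_comm, ← nsmul_eq_mul, LinearMap.smul_apply, key, smul_zero]

omit [FiniteDimensional K V] in
/-- A non-zero vector has at most one generalised eigenvalue label. [folklore] -/
theorem genEigenvalue_unique {f : End K V} {μ ν : K} {v : V} (hv : v ≠ 0)
    (hμ : ∃ k : ℕ, ((f - μ • (1 : End K V)) ^ k) v = 0)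
    (hν : ∃ k : ℕ, ((f - ν • (1 : End K V)) ^ k) v = 0) : μ = ν := by
  by_contra hne
  have hd := Module.End.disjoint_genEigenspace f hne ⊤ ⊤
  have h1 : v ∈ f.maxGenEigenspace μ := (mem_maxGenEigenspace f μ v).2 hμ
  have h2 : v ∈ f.maxGenEigenspace ν := (mem_maxGenEigenspace f ν v).2 hν
  exact hv ((Submodule.disjoint_def.1 hd) v h1 h2)

/-- **E3.** Over an algebraically closed field, a linear space `S` of pairwise commuting
endomorphisms of a finite-dimensional space `V` with `dim S > dim V` contains a non-zero nilpotent
element.  (Simultaneous generalised eigenspace decomposition `V = ⊕_χ V_χ` with at most `dim V`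
non-zero pieces; the labels `χ` are linear on `S`; an element of `S` with all labels zero is
nilpotent on every `V_χ`, hence nilpotent; rank–nullity.) [folklore] -/
theorem exists_ne_zero_isNilpotent_of_finrank_lt [IsAlgClosed K] (S : Submodule K (End K V))
    (hcomm : ∀ f ∈ S, ∀ g ∈ S, Commute f g) (hlt : finrank K V < finrank K S) :
    ∃ f ∈ S, f ≠ 0 ∧ IsNilpotent f := by
  classical
  set F : S → End K V := fun X => (X : End K V) with hF
  set E : (S → K) → Submodule K V := fun χ => ⨅ X : S, (F X).maxGenEigenspace (χ X) with hE
  have hmaps : ∀ i j : S, ∀ φ : K,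
      MapsTo (F i) ((F j).maxGenEigenspace φ) ((F j).maxGenEigenspace φ) :=
    fun i j φ => mapsTo_maxGenEigenspace_of_comm (hcomm _ j.2 _ i.2) φ
  have hind : iSupIndep E := Module.End.independent_iInf_maxGenEigenspace_of_forall_mapsTo F hmaps
  have htop : ⨆ χ, E χ = ⊤ := Module.End.iSup_iInf_maxGenEigenspace_eq_top_of_forall_mapsTo F
    hmaps fun X => Module.End.iSup_maxGenEigenspace_eq_top (F X)
  haveI : Fintype {χ // E χ ≠ ⊥} := hind.fintypeNeBotOfFiniteDimensional
  have hcard : Fintype.card {χ // E χ ≠ ⊥} ≤ finrank K V := hind.subtype_ne_bot_le_finrank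
  -- the pointwise annihilation on `E χ`
  have hptw : ∀ (χ : S → K) (X : S), ∀ v ∈ E χ,
      ((F X - χ X • (1 : End K V)) ^ finrank K V) v = 0 := fun χ X v hv =>
    pow_finrank_apply_of_mem_maxGenEigenspace (F X) (χ X) ((Submodule.mem_iInf _).1 hv X)
  -- the labels are linear on `S`
  have hadd : ∀ χ : {χ // E χ ≠ ⊥}, ∀ X Y : S, χ.1 (X + Y) = χ.1 X + χ.1 Y := by
    intro χ X Y
    obtain ⟨v, hv, hv0⟩ := Submodule.exists_mem_ne_zero_of_ne_bot χ.2
    refine genEigenvalue_unique (f := F (X + Y)) hv0 ⟨finrank K V, hptw χ.1 (X + Y) v hv⟩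
      ⟨finrank K V + finrank K V, ?_⟩
    have hc : Commute (F X - χ.1 X • (1 : End K V)) (F Y - χ.1 Y • (1 : End K V)) :=
      ((hcomm _ X.2 _ Y.2).sub_right ((Commute.one_right _).smul_right _)).sub_left
        (((Commute.one_left _).smul_left _).sub_right
          (((Commute.one_left _).smul_left _).smul_right _))
    have heq : F (X + Y) - (χ.1 X + χ.1 Y) • (1 : End K V) =
        (F X - χ.1 X • (1 : End K V)) + (F Y - χ.1 Y • (1 : End K V)) := by
      simp only [hF, Submodule.coe_add, add_smul]; abel
    rw [heq]
    exact add_pow_apply_eq_zero hc (hptw χ.1 X v hv) (hptw χ.1 Y v hv)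
  have hsmul : ∀ χ : {χ // E χ ≠ ⊥}, ∀ (c : K) (X : S), χ.1 (c • X) = c * χ.1 X := by
    intro χ c X
    obtain ⟨v, hv, hv0⟩ := Submodule.exists_mem_ne_zero_of_ne_bot χ.2
    refine genEigenvalue_unique (f := F (c • X)) hv0 ⟨finrank K V, hptw χ.1 (c • X) v hv⟩
      ⟨finrank K V, ?_⟩
    have heq : F (c • X) - (c * χ.1 X) • (1 : End K V) = c • (F X - χ.1 X • (1 : End K V)) := by
      simp only [hF, Submodule.coe_smul, smul_sub, mul_smul]
    rw [heq, smul_pow, LinearMap.smul_apply, hptw χ.1 X v hv, smul_zero]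
  -- the label map and rank–nullity
  let Φ : S →ₗ[K] ({χ // E χ ≠ ⊥} → K) :=
    { toFun := fun X χ => χ.1 X
      map_add' := fun X Y => funext fun χ => hadd χ X Y
      map_smul' := fun c X => funext fun χ => hsmul χ c X }
  have hker : LinearMap.ker Φ ≠ ⊥ := by
    intro hbot
    have hinj : Function.Injective Φ := LinearMap.ker_eq_bot.1 hbot
    have h1 := LinearMap.finrank_range_of_inj hinj
    have h2 : finrank K (LinearMap.range Φ) ≤ finrank K ({χ // E χ ≠ ⊥} → K) :=
      Submodule.finrank_le _
    rw [Module.finrank_fintype_fun_eq_card] at h2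
    omega
  obtain ⟨X, hXker, hX0⟩ := Submodule.exists_mem_ne_zero_of_ne_bot hker
  refine ⟨(X : End K V), X.2, fun h => hX0 (Subtype.ext h), finrank K V, ?_⟩
  have hlab (χ : {χ // E χ ≠ ⊥}) : χ.1 X = 0 := by
    simpa [Φ] using congr_fun (LinearMap.mem_ker.1 hXker) χ
  have hkill : ∀ χ, ∀ v ∈ E χ, ((X : End K V) ^ finrank K V) v = 0 := by
    intro χ v hv
    by_cases hχ : E χ = ⊥
    · rw [show v = 0 by simpa [hχ] using hv, map_zero]
    · have h0 : χ X = 0 := hlab ⟨χ, hχ⟩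
      have := hptw χ X v hv
      rwa [h0, zero_smul, sub_zero] at this
  refine LinearMap.ext fun v => ?_
  have hv : v ∈ ⨆ χ, E χ := by rw [htop]; exact Submodule.mem_top
  rw [LinearMap.zero_apply]
  exact Submodule.iSup_induction E (motive := fun v => ((X : End K V) ^ finrank K V) v = 0) hv
    hkill (map_zero _) fun a b ha hb => by rw [map_add, ha, hb, add_zero]

/-- **E3 for matrices.** A linear space of pairwise commuting `n × n` matrices over an
algebraically closed field of dimension `> n` contains a non-zero nilpotent matrix. [folklore] -/
theorem exists_ne_zero_isNilpotent_matrix_of_card_lt [IsAlgClosed K] {n : Type*} [Fintype n]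
    [DecidableEq n] (S : Submodule K (Matrix n n K)) (hcomm : ∀ A ∈ S, ∀ B ∈ S, A * B = B * A)
    (hlt : Fintype.card n < finrank K S) : ∃ A ∈ S, A ≠ 0 ∧ IsNilpotent A := by
  set e : Matrix n n K ≃ₐ[K] End K (n → K) := Matrix.toLinAlgEquiv' with he
  set S' : Submodule K (End K (n → K)) := S.map e.toLinearEquiv.toLinearMap with hS'
  have hcomm' : ∀ f ∈ S', ∀ g ∈ S', Commute f g := by
    intro f hf g hg
    obtain ⟨⟨A, hA, rfl⟩, ⟨B, hB, rfl⟩⟩ := And.intro (Submodule.mem_map.1 hf) (Submodule.mem_map.1 hg)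
    change e A * e B = e B * e A
    rw [← map_mul, ← map_mul, hcomm A hA B hB]
  have hlt' : finrank K (n → K) < finrank K S' := by
    rw [Module.finrank_fintype_fun_eq_card, hS', LinearEquiv.finrank_map_eq]
    exact hlt
  obtain ⟨f, hf, hf0, k, hk⟩ := exists_ne_zero_isNilpotent_of_finrank_lt S' hcomm' hlt'
  obtain ⟨A, hA, rfl⟩ := Submodule.mem_map.1 hf
  refine ⟨A, hA, fun h => hf0 (show e A = 0 by rw [h, map_zero]), k, e.injective ?_⟩
  rw [map_pow, map_zero]; exact hk

end E3

/-! ## The 111-space: products, powers, injectivity, commutativity -/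

section Algebra

variable {K : Type*} [Field K] {ι κ μ : Type*} [Fintype ι] [Fintype κ] [Fintype μ]

omit [Fintype κ] [Fintype μ] in
/-- `(P P') ·₁ T = P ·₁ (P' ·₁ T)`. [folklore] -/
theorem contract₁_mul (P P' : Matrix ι ι K) (T : ι → κ → μ → K) :
    contract₁ (P * P') T = contract₁ P (contract₁ P' T) := by
  funext z x y
  simp only [contract₁_apply, Matrix.mul_apply, Finset.sum_mul, Finset.mul_sum, mul_assoc]
  rw [Finset.sum_comm]

omit [Fintype ι] [Fintype μ] in
/-- `(Q Q') ·₂ T = Q ·₂ (Q' ·₂ T)`. [folklore] -/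
theorem contract₂_mul (Q Q' : Matrix κ κ K) (T : ι → κ → μ → K) :
    contract₂ (Q * Q') T = contract₂ Q (contract₂ Q' T) := by
  funext z x y
  simp only [contract₂_apply, Matrix.mul_apply, Finset.sum_mul, Finset.mul_sum, mul_assoc]
  rw [Finset.sum_comm]

omit [Fintype ι] [Fintype κ] in
/-- `(R R') ·₃ T = R ·₃ (R' ·₃ T)`. [folklore] -/
theorem contract₃_mul (Rm Rm' : Matrix μ μ K) (T : ι → κ → μ → K) :
    contract₃ (Rm * Rm') T = contract₃ Rm (contract₃ Rm' T) := by
  funext z x y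
  simp only [contract₃_apply, Matrix.mul_apply, Finset.sum_mul, Finset.mul_sum, mul_assoc]
  rw [Finset.sum_comm]

omit [Fintype μ] in
/-- Contractions of different legs commute: legs 1 and 2. [folklore] -/
theorem contract₁_contract₂ (P : Matrix ι ι K) (Q : Matrix κ κ K) (T : ι → κ → μ → K) :
    contract₁ P (contract₂ Q T) = contract₂ Q (contract₁ P T) := by
  funext z x y
  simp only [contract₁_apply, contract₂_apply, Finset.mul_sum]
  rw [Finset.sum_comm]
  refine Finset.sum_congr rfl fun x' _ => Finset.sum_congr rfl fun z' _ => by ring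

omit [Fintype κ] in
/-- Contractions of different legs commute: legs 1 and 3. [folklore] -/
theorem contract₁_contract₃ (P : Matrix ι ι K) (Rm : Matrix μ μ K) (T : ι → κ → μ → K) :
    contract₁ P (contract₃ Rm T) = contract₃ Rm (contract₁ P T) := by
  funext z x y
  simp only [contract₁_apply, contract₃_apply, Finset.mul_sum]
  rw [Finset.sum_comm]
  refine Finset.sum_congr rfl fun y' _ => Finset.sum_congr rfl fun z' _ => by ring

omit [Fintype ι] in
/-- Contractions of different legs commute: legs 2 and 3. [folklore] -/
theorem contract₂_contract₃ (Q : Matrix κ κ K) (Rm : Matrix μ μ K) (T : ι → κ → μ → K) :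
    contract₂ Q (contract₃ Rm T) = contract₃ Rm (contract₂ Q T) := by
  funext z x y
  simp only [contract₂_apply, contract₃_apply, Finset.mul_sum]
  rw [Finset.sum_comm]
  refine Finset.sum_congr rfl fun y' _ => Finset.sum_congr rfl fun x' _ => by ring

omit [Fintype κ] [Fintype μ] in
/-- `contract₁` is additive in the matrix. [folklore] -/
theorem contract₁_sub (P P' : Matrix ι ι K) (T : ι → κ → μ → K) :
    contract₁ (P - P') T = contract₁ P T - contract₁ P' T := by
  funext z x y
  simp only [contract₁_apply, Pi.sub_apply, Matrix.sub_apply, sub_mul, Finset.sum_sub_distrib]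

/-- Membership of a triple of matrices in the 111-space `𝔞(T)`: `P ·₁ T = Q ·₂ T = R ·₃ T`.
[cite: JelisiejewLandsbergPal2023, Def. 1.9] -/
def IsTriple (T : ι → κ → μ → K) (P : Matrix ι ι K) (Q : Matrix κ κ K) (Rm : Matrix μ μ K) :
    Prop :=
  contract₁ P T = contract₂ Q T ∧ contract₂ Q T = contract₃ Rm T

/-- The first block of a flattened triple. [folklore] -/
def projA : (TripleIndex ι κ μ → K) →ₗ[K] Matrix ι ι K where
  toFun c := Matrix.of fun z z' => c (Sum.inl (z, z'))
  map_add' _ _ := rfl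
  map_smul' _ _ := rfl

/-- The second block of a flattened triple. [folklore] -/
def projB (c : TripleIndex ι κ μ → K) : Matrix κ κ K := Matrix.of fun x x' => c (Sum.inr (Sum.inl (x, x')))

/-- The third block of a flattened triple. [folklore] -/
def projC (c : TripleIndex ι κ μ → K) : Matrix μ μ K := Matrix.of fun y y' => c (Sum.inr (Sum.inr (y, y')))

/-- Kernel vectors of `lin111 T` are triples of `𝔞(T)`. [folklore] -/
theorem isTriple_of_lin111_eq_zero {T : ι → κ → μ → K} {c : TripleIndex ι κ μ → K}
    (h : lin111 T c = 0) : IsTriple T (projA c) (projB c) (projC c) :=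
  (lin111_eq_zero_iff T c).1 h

/-- **Product closure without commutativity**: `(P,Q,R), (P',Q',R') ∈ 𝔞(T)` give
`(P P', Q' Q, R' R) ∈ 𝔞(T)`. [cite: JelisiejewLandsbergPal2023, Thm. 1.10 (proof)] -/
theorem IsTriple.mul {T : ι → κ → μ → K} {P P' : Matrix ι ι K} {Q Q' : Matrix κ κ K}
    {Rm Rm' : Matrix μ μ K} (h : IsTriple T P Q Rm) (h' : IsTriple T P' Q' Rm') :
    IsTriple T (P * P') (Q' * Q) (Rm' * Rm) := by
  have e2 : contract₁ (P * P') T = contract₂ (Q' * Q) T := by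
    rw [contract₁_mul, h'.1, contract₁_contract₂, h.1, ← contract₂_mul]
  have e3 : contract₁ (P * P') T = contract₃ (Rm' * Rm) T := by
    rw [contract₁_mul, h'.1.trans h'.2, contract₁_contract₃, h.1.trans h.2, ← contract₃_mul]
  exact ⟨e2, e2.symm.trans e3⟩

/-- Powers of a triple of `𝔞(T)` lie in `𝔞(T)`. [cite: JelisiejewLandsbergPal2023, Thm. 1.10] -/
theorem IsTriple.pow [DecidableEq ι] [DecidableEq κ] [DecidableEq μ] {T : ι → κ → μ → K} {P : Matrix ι ι K} {Q : Matrix κ κ K} {Rm : Matrix μ μ K}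
    (h : IsTriple T P Q Rm) : ∀ j : ℕ, IsTriple T (P ^ (j + 1)) (Q ^ (j + 1)) (Rm ^ (j + 1))
  | 0 => by simpa using h
  | j + 1 => by
    have ih := IsTriple.pow h j
    have := h.mul ih
    rwa [← pow_succ', ← pow_succ, ← pow_succ] at this

omit [Fintype κ] [Fintype μ] in
/-- `A`-conciseness: `P ·₁ T = 0 ⟹ P = 0`. [cite: JelisiejewLandsbergPal2023, §1.1] -/
theorem eq_zero_of_contract₁_eq_zero {T : ι → κ → μ → K} (hA : LinearIndependent K fun z => T z)
    {P : Matrix ι ι K} (h : contract₁ P T = 0) : P = 0 := by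
  ext z z'
  refine Fintype.linearIndependent_iff.1 hA (fun z' => P z z') ?_ z'
  funext x y
  have := congr_fun (congr_fun (congr_fun h z) x) y
  simpa [contract₁_apply, Finset.sum_apply] using this

omit [Fintype ι] [Fintype μ] in
/-- `B`-conciseness: `Q ·₂ T = 0 ⟹ Q = 0`. [cite: JelisiejewLandsbergPal2023, §1.1] -/
theorem eq_zero_of_contract₂_eq_zero {T : ι → κ → μ → K}
    (hB : LinearIndependent K fun x => rotate T x) {Q : Matrix κ κ K} (h : contract₂ Q T = 0) :
    Q = 0 := by
  ext x x'
  refine Fintype.linearIndependent_iff.1 hB (fun x' => Q x x') ?_ x'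
  funext y z
  have := congr_fun (congr_fun (congr_fun h z) x) y
  simpa [contract₂_apply, Finset.sum_apply, rotate] using this

omit [Fintype ι] [Fintype κ] in
/-- `C`-conciseness: `R ·₃ T = 0 ⟹ R = 0`. [cite: JelisiejewLandsbergPal2023, §1.1] -/
theorem eq_zero_of_contract₃_eq_zero {T : ι → κ → μ → K}
    (hC : LinearIndependent K fun y => rotate (rotate T) y) {Rm : Matrix μ μ K}
    (h : contract₃ Rm T = 0) : Rm = 0 := by
  ext y y'
  refine Fintype.linearIndependent_iff.1 hC (fun y' => Rm y y') ?_ y'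
  funext z x
  have := congr_fun (congr_fun (congr_fun h z) x) y
  simpa [contract₃_apply, Finset.sum_apply, rotate] using this

/-- **Commutativity of the first projection of `𝔞(T)`** for `A`-concise `T` (the chain
`PP'·₁T = P·₁(Q'·₂T) = Q'·₂(R·₃T) = R·₃(P'·₁T) = P'·₁(P·₁T)`).
[cite: JelisiejewLandsbergPal2023, Thm. 1.10] -/
theorem IsTriple.comm₁ {T : ι → κ → μ → K} (hA : LinearIndependent K fun z => T z)
    {P P' : Matrix ι ι K} {Q Q' : Matrix κ κ K} {Rm Rm' : Matrix μ μ K} (h : IsTriple T P Q Rm)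
    (h' : IsTriple T P' Q' Rm') : P * P' = P' * P := by
  have hchain : contract₁ (P * P') T = contract₁ (P' * P) T := by
    rw [contract₁_mul, h'.1, contract₁_contract₂, h.1.trans h.2, contract₂_contract₃, ← h'.1,
      ← contract₁_contract₃, ← h.1.trans h.2, ← contract₁_mul]
  have h0 : contract₁ (P * P' - P' * P) T = 0 := by rw [contract₁_sub, hchain, sub_self]
  exact sub_eq_zero.1 (eq_zero_of_contract₁_eq_zero hA h0)

/-- For concise `T`, the first projection is injective on `𝔞(T)`. [cite: JelisiejewLandsbergPal2023, Thm. 1.10] -/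
theorem projA_injOn_ker {T : ι → κ → μ → K} (hT : IsConcise3 T) :
    Set.InjOn (projA : (TripleIndex ι κ μ → K) →ₗ[K] Matrix ι ι K) (LinearMap.ker (lin111 T)) := by
  -- linear, so it suffices that the kernel of the restriction is trivial
  intro c hc c' hc' hcc'
  have hmem : c - c' ∈ LinearMap.ker (lin111 T) := Submodule.sub_mem _ hc hc'
  have hPA : projA (c - c') = 0 := by rw [map_sub, hcc', sub_self]
  obtain ⟨h12, h23⟩ := isTriple_of_lin111_eq_zero (LinearMap.mem_ker.1 hmem)
  have hP0 : contract₁ (projA (c - c')) T = 0 := by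
    rw [hPA]; funext z x y; simp [contract₁_apply]
  have hQ : projB (c - c') = 0 := eq_zero_of_contract₂_eq_zero hT.2.1 (h12 ▸ hP0)
  have hR : projC (c - c') = 0 := eq_zero_of_contract₃_eq_zero hT.2.2 (h23 ▸ h12 ▸ hP0)
  rw [← sub_eq_zero]
  funext t
  rcases t with ⟨z, z'⟩ | ⟨x, x'⟩ | ⟨y, y'⟩
  · have := congr_fun (congr_fun hPA z) z'; simpa [projA] using this
  · have := congr_fun (congr_fun hQ x) x'; simpa [projB] using this
  · have := congr_fun (congr_fun hR y) y'; simpa [projC] using this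

/-- **A concise, 111-abundant, non-111-sharp tensor carries a non-zero square-zero triple in its
111-space** (over an algebraically closed field): if `|Z| < dim 𝔞(T)` then there are `P ≠ 0`,
`Q`, `R` with `P² = Q² = R² = 0` and `P ·₁ T = Q ·₂ T = R ·₃ T`.
[cite: JelisiejewLandsbergPal2023, Thm. 1.10, §1.4.1] -/
theorem exists_sqZero_triple_of_card_lt_finrank_ker_lin111 [IsAlgClosed K] [DecidableEq ι] [DecidableEq κ]
    [DecidableEq μ] (T : ι → κ → μ → K)
    (hT : IsConcise3 T) (hlt : Fintype.card ι < Module.finrank K (LinearMap.ker (lin111 T))) :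
    ∃ (P : Matrix ι ι K) (Q : Matrix κ κ K) (Rm : Matrix μ μ K),
      P ≠ 0 ∧ P * P = 0 ∧ Q * Q = 0 ∧ Rm * Rm = 0 ∧ IsTriple T P Q Rm := by
  classical
  -- the first projection of `𝔞(T)`, a commuting space of matrices of the same dimension
  set S : Submodule K (Matrix ι ι K) := (LinearMap.ker (lin111 T)).map projA with hS
  have hdim : Module.finrank K S = Module.finrank K (LinearMap.ker (lin111 T)) := by
    rw [hS, ← LinearMap.range_domRestrict]
    exact LinearMap.finrank_range_of_inj fun c c' h =>
      Subtype.ext ((projA_injOn_ker hT) c.2 c'.2 (by simpa using h))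
  have hcomm : ∀ A ∈ S, ∀ B ∈ S, A * B = B * A := by
    intro A hA B hB
    obtain ⟨⟨c, hc, rfl⟩, ⟨c', hc', rfl⟩⟩ := And.intro (Submodule.mem_map.1 hA) (Submodule.mem_map.1 hB)
    exact (isTriple_of_lin111_eq_zero (LinearMap.mem_ker.1 hc)).comm₁ hT.1
      (isTriple_of_lin111_eq_zero (LinearMap.mem_ker.1 hc'))
  obtain ⟨N, hNS, hN0, hNnil⟩ := exists_ne_zero_isNilpotent_matrix_of_card_lt S hcomm (hdim ▸ hlt)
  obtain ⟨c, hc, rfl⟩ := Submodule.mem_map.1 hNS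
  have htr : IsTriple T (projA c) (projB c) (projC c) :=
    isTriple_of_lin111_eq_zero (LinearMap.mem_ker.1 hc)
  -- the minimal `m` with `N^{m+1} = 0`; then `m ≥ 1`, `N^m ≠ 0`, `(N^m)² = 0`
  have hex : ∃ m : ℕ, projA c ^ (m + 1) = 0 := by
    obtain ⟨k, hk⟩ := hNnil
    exact ⟨k, by rw [pow_succ, hk, zero_mul]⟩
  let m := Nat.find hex
  have hm : projA c ^ (m + 1) = 0 := Nat.find_spec hex
  have hm1 : 1 ≤ m := by
    by_contra h0
    rw [show m = 0 by omega, zero_add, pow_one] at hm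
    exact hN0 hm
  obtain ⟨j, hj⟩ := Nat.exists_eq_add_of_le hm1
  have hmne : projA c ^ m ≠ 0 := fun h0 =>
    Nat.find_min hex (show j < m by omega) (by rw [add_comm, ← hj]; exact h0)
  have hpow := htr.pow j
  rw [show j + 1 = m by omega] at hpow
  have hP2 : projA c ^ m * projA c ^ m = 0 := by
    rw [← pow_add, show m + m = (m + 1) + (m - 1) by omega, pow_add, hm, zero_mul]
  have hpow2 := htr.pow (m + m - 1)
  rw [show m + m - 1 + 1 = m + m by omega] at hpow2
  have hP2' : contract₁ (projA c ^ (m + m)) T = 0 := by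
    rw [pow_add, hP2]; funext z x y; simp [contract₁_apply]
  have hQ2 : projB c ^ m * projB c ^ m = 0 := by
    rw [← pow_add]; exact eq_zero_of_contract₂_eq_zero hT.2.1 (hpow2.1 ▸ hP2')
  have hR2 : projC c ^ m * projC c ^ m = 0 := by
    rw [← pow_add]; exact eq_zero_of_contract₃_eq_zero hT.2.2 (hpow2.2 ▸ hpow2.1 ▸ hP2')
  exact ⟨projA c ^ m, projB c ^ m, projC c ^ m, hmne, hP2, hQ2, hR2, hpow⟩

end Algebra

end OneOneOneAlgebra

end Summit.MatrixMultiplication.MatrixMultiplication.Theorems
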